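import Summits.CriticalPhenomena.CardyFormulaZ2.Theses.CardyExpCovariance
import Literature.Probability.Percolation.InterfaceScalingLimitDiscretised
import Literature.Probability.RandomPlanarGeometry.ChordalCurveFamily
import Literature.Probability.RandomPlanarGeometry.SLEUniquenessInLaw

/-!
# Birth skeleton (BC3) for piece X₁ `SeqKernelForcesSLE` of the split of `CardyRigiditySeq` (stmt-CriticalPhenomena-4680)

Route `CardyExpCovariance`; the piece is filed by the crux strategist as a child of the crux
`CardyRigiditySeq` (children.json of the split; the route decl does not exist yet, so the piece is
restated verbatim here as `SeqKernelForcesSLE`).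

    SeqKernelForcesSLE := ∀ u f, u_k → 0⁺ → HYPSEQ u f → ∃ κ > 0, LIMSEQ κ u

(`HYPSEQ u f`: along the mesh sequence `u` the bond-ℤ² crossing probabilities of every conformal
rectangle converge to `f (cross-ratio)`; `LIMSEQ κ u`: for every Dobrushin domain and every
admissible discretisation family the medial exploration interface converges in law ALONG `u`
(bounded continuous test functions on `CurveClass ℂ`) to a chordal SLE_κ random curve.)

The line (Camia–Newman 2007 §§5–7 / Smirnov 2001 Thm 2, run with an UNKNOWN kernel along ONE
sequence) cut along its two classical halves:

* `stub_subseqLimitLaw` (TIGHTNESS, size M/L): along every subsequence of `u` a further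
  subsequence of the interface laws converges (portmanteau sense) to SOME Borel measure on
  `CurveClass ℂ` — Aizenman–Burchard tightness for admissible families (the tree fact
  `isTightLaws_map_bondInterface` covers the canonical data) + Prokhorov on the curve space.
* `stub_subseqLimitIsSLE` (IDENTIFICATION, size XL — the heart): under `HYPSEQ u f` there is ONE
  `κ > 0` such that every such subsequential limit law, in every Dobrushin domain and for every
  admissible family, is the chordal SLE_κ law (the kernel `f` fixes the exit distributions of the
  limit; conformal invariance of `f` + discrete domain Markov passed to the limit + Schramm's
  principle).

Composition `SeqKernelForcesSLE_of` (real proof): subsequence principle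
(`Filter.tendsto_of_subseq_tendsto`, `Filter.strictMono_subseq_of_tendsto_atTop`) + uniqueness of
the chordal SLE_κ law (`IsSLELaw.unique` with the PROVED `IsSLECurve.map_eq_holds`) +
`integral_map`: all subsequential limits are the same SLE_κ law, so the whole sequence converges to
the law of one SLE_κ random curve `Γ`.
-/

noncomputable section

namespace Summit.CriticalPhenomena.CardyFormulaZ2.Cruxes.CardyRigiditySeq.BirthSeqKernelForcesSLE

open scoped NNReal Topology
open MeasureTheory Filter Set
open Literature.Probability.RandomPlanarGeometry Literature.Probability.LatticeModels

/-- Piece X₁ of the split of `CardyRigiditySeq`, restated VERBATIM from the strategist's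
children.json (the route decl `Theses.CardyExpCovariance.SeqKernelForcesSLE` is written by the gate
when the split is applied). -/
def SeqKernelForcesSLE : Prop :=
  ∀ (u : ℕ → ℝ) (f : ℝ → ℝ), Filter.Tendsto u Filter.atTop (nhdsWithin 0 (Set.Ioi 0)) → (∀ (R : Literature.Probability.RandomPlanarGeometry.ConformalRectangle) (φ : Literature.Probability.RandomPlanarGeometry.ConformalEquiv UpperHalfPlane.upperHalfPlaneSet R.carrier) (x : Fin 4 → ℝ), R.IsUniformizing φ x → Filter.Tendsto (fun k ↦ Literature.Probability.Percolation.bondDomainCrossingProb R (u k)) Filter.atTop (nhds (f (Literature.Probability.RandomPlanarGeometry.crossRatio x)))) → ∃ κ : NNReal, 0 < κ ∧ ∀ (D : Literature.Probability.RandomPlanarGeometry.DobrushinDomain) (E : ℝ → Literature.Probability.LatticeModels.DiscreteDobrushin), Literature.Probability.LatticeModels.ZdDiscretisationFamily D E → ∃ Γ : (NNReal → ℝ) → Literature.Probability.RandomPlanarGeometry.CurveClass ℂ, Literature.Probability.RandomPlanarGeometry.IsSLECurve κ D Γ ∧ ∀ g : BoundedContinuousFunction (Literature.Probability.RandomPlanarGeometry.CurveClass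 ℂ) ℝ, Filter.Tendsto (fun k ↦ ∫ ω, g (Literature.Probability.Percolation.bondInterfaceIn D (E (u k)) ω) ∂(Literature.Probability.Percolation.bondPercolation (Literature.Probability.LatticeModels.zdGraph 2) Literature.Probability.Percolation.half)) Filter.atTop (nhds (∫ ω, g (Γ ω) ∂Literature.Probability.Process.preWienerMeasure))

/-- STUB T — **tightness / subsequential limit laws along admissible families** (Aizenman–Burchard
1999 Thm 1.2 + Prokhorov; size M/L). -/
protected theorem Holds.stub_subseqLimitLaw :
    ∀ (u : ℕ → ℝ), Filter.Tendsto u Filter.atTop (nhdsWithin 0 (Set.Ioi 0)) → ∀ (D : Literature.Probability.RandomPlanarGeometry.DobrushinDomain) (E : ℝ → Literature.Probability.LatticeModels.DiscreteDobrushin), Literature.Probability.LatticeModels.ZdDiscretisationFamily D E → ∀ ψ : ℕ → ℕ, StrictMono ψ → ∃ φ' : ℕ → ℕ, StrictMono φ' ∧ ∃ P : MeasureTheory.Measure (Literature.Probability.RandomPlanarGeometry.CurveClass ℂ), ∀ g : BoundedContinuousFunction (Literature.Probability.RandomPlanarGeometry.CurveClass ℂ) ℝ, Filter.Tendsto (fun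 k ↦ ∫ ω, g (Literature.Probability.Percolation.bondInterfaceIn D (E (u (ψ (φ' k)))) ω) ∂(Literature.Probability.Percolation.bondPercolation (Literature.Probability.LatticeModels.zdGraph 2) Literature.Probability.Percolation.half)) Filter.atTop (nhds (∫ γ, g γ ∂P)) := by
  sorry

/-- By-name handle of the registered stub `Holds.stub_subseqLimitLaw` (D-0027 §3.3 device). -/
def stub_subseqLimitLaw : Prop := type_of% Holds.stub_subseqLimitLaw

/-- STUB I — **identification of every subsequential limit as THE SLE_κ law, one κ for all**
(Camia–Newman 2007 §§5–7 / Smirnov 2001 Thm 2 with an unknown conformally invariant kernel;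
Schramm 2000 §1.5; size XL, the heart of the piece). -/
protected theorem Holds.stub_subseqLimitIsSLE :
    ∀ (u : ℕ → ℝ) (f : ℝ → ℝ), Filter.Tendsto u Filter.atTop (nhdsWithin 0 (Set.Ioi 0)) → (∀ (R : Literature.Probability.RandomPlanarGeometry.ConformalRectangle) (φ : Literature.Probability.RandomPlanarGeometry.ConformalEquiv UpperHalfPlane.upperHalfPlaneSet R.carrier) (x : Fin 4 → ℝ), R.IsUniformizing φ x → Filter.Tendsto (fun k ↦ Literature.Probability.Percolation.bondDomainCrossingProb R (u k)) Filter.atTop (nhds (f (Literature.Probability.RandomPlanarGeometry.crossRatio x)))) → ∃ κ : NNReal, 0 < κ ∧ ∀ (D : Literature.Probability.RandomPlanarGeometry.DobrushinDomain) (E : ℝ → Literature.Probability.LatticeModels.DiscreteDobrushin), Literature.Probability.LatticeModels.ZdDiscretisationFamily D E → ∀ ψ : ℕ → ℕ, StrictMono ψ → ∀ P : MeasureTheory.Measure (Literature.Probability.RandomPlanarGeometry.CurveClass ℂ), (∀ g : BoundedContinuousFunction (Literature.Probability.RandomPlanarGeometry.CurveClass ℂ) ℝ, Filter.Tendsto (fun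 k ↦ ∫ ω, g (Literature.Probability.Percolation.bondInterfaceIn D (E (u (ψ k))) ω) ∂(Literature.Probability.Percolation.bondPercolation (Literature.Probability.LatticeModels.zdGraph 2) Literature.Probability.Percolation.half)) Filter.atTop (nhds (∫ γ, g γ ∂P))) → Literature.Probability.RandomPlanarGeometry.IsSLELaw κ D P := by
  sorry

/-- By-name handle of the registered stub `Holds.stub_subseqLimitIsSLE` (D-0027 §3.3 device). -/
def stub_subseqLimitIsSLE : Prop := type_of% Holds.stub_subseqLimitIsSLE

/-- **Composition (real proof):** tightness + identification give full convergence along `u` to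
one SLE_κ random curve, i.e. the piece `SeqKernelForcesSLE` BY NAME. -/
theorem SeqKernelForcesSLE_of : stub_subseqLimitLaw → stub_subseqLimitIsSLE → SeqKernelForcesSLE := by
  intro hT hI
  dsimp only [stub_subseqLimitLaw, stub_subseqLimitIsSLE] at hT hI
  intro u f hu hf
  obtain ⟨κ, hκ, hid⟩ := hI u f hu hf
  refine ⟨κ, hκ, fun D E hE ↦ ?_⟩
  -- a first subsequential limit law, identified as an SLE_κ law: this fixes the limit curve `Γ`
  obtain ⟨φ₀, hφ₀, P₀, hconv₀⟩ := hT u hu D E hE id strictMono_id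
  have hsle₀ : IsSLELaw κ D P₀ := hid D E hE (id ∘ φ₀) (strictMono_id.comp hφ₀) P₀ hconv₀
  obtain ⟨Γ, hΓ, rfl⟩ := hsle₀
  refine ⟨Γ, hΓ, fun g ↦ ?_⟩
  -- every subsequence has a further subsequence along which the integrals converge to the SAME
  -- value `∫ g ∘ Γ dW` (uniqueness of the SLE_κ law), hence the whole sequence converges
  refine tendsto_of_subseq_tendsto fun ns hns ↦ ?_
  obtain ⟨φ, hφ, hmono⟩ := strictMono_subseq_of_tendsto_atTop hns
  obtain ⟨φ', hφ', P, hconv⟩ := hT u hu D E hE (ns ∘ φ) hmono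
  have hsle : IsSLELaw κ D P := hid D E hE ((ns ∘ φ) ∘ φ') (hmono.comp hφ') P hconv
  have hPeq : P = Literature.Probability.Process.preWienerMeasure.map Γ :=
    IsSLELaw.unique IsSLECurve.map_eq_holds hsle hΓ.isSLELaw_map
  refine ⟨φ ∘ φ', ?_⟩
  have h := hconv g
  rw [hPeq, integral_map hΓ.aemeasurable g.continuous.aestronglyMeasurable] at h
  simpa [Function.comp_def] using h

/-- The piece, conditionally on the two registered stubs (the only `sorry`s of this file are
inside `Holds.stub_*`); certifies that the handles ARE the stub statements. -/
theorem seqKernelForcesSLE_of_stubs : SeqKernelForcesSLE :=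
  SeqKernelForcesSLE_of Holds.stub_subseqLimitLaw Holds.stub_subseqLimitIsSLE

end Summit.CriticalPhenomena.CardyFormulaZ2.Cruxes.CardyRigiditySeq.BirthSeqKernelForcesSLE

end
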